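import Mathlib

/-!
# Hub mass: one good common value, and the split constraint

Crux `Summit.MatrixMultiplication.MatrixMultiplication.Theses.SnSubsetDichotomy.PolynomialSlack`
(item `stmt-MatrixMultiplication-8306`), level-one programme, line transport-split-hull (lead c9).
At a position `k` of a TPP triple `(S,T,U)` one has a probability vector `μ` over the values
(`μ(v) = P(u k = v)`) and two `[0,1]`-valued profiles `X(v) = P_T(t⁻¹ v ∈ J)`,
`Y(v) = P_S(s⁻¹ v ∈ I)`. The FORCED HITS `Σ_v X(v) Y(v)` are `μ`-free while the HUB MASS
`Σ_v μ(v) X(v) Y(v)` is `μ`-weighted.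

* `exists_good_value_of_hubMass`: hub mass `≥ h` and forced hits `≤ Z` force one value `v` with
  `μ(v) X(v) Y(v) ≥ h² / (4 Z)`.
  Proof. Put `μ₀ := h / (2Z)` and let `m := max_v μXY`. Pointwise `μXY ≤ μ₀·XY + (m/μ₀)·μ`
  (if `μ(v) ≤ μ₀` the first term dominates; otherwise `μXY ≤ m ≤ (m/μ₀) μ`). Summing,
  `h ≤ μ₀ Z + m/μ₀ = h/2 + 2Zm/h`, i.e. `m ≥ h²/(4Z)`.
* `hubMass_ge_add_sub_one`: the split constraint `Σ μX + Σ μY - 1 ≤ Σ μXY`, from the pointwise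
  inequality `X + Y - 1 ≤ XY` (i.e. `(1 - X)(1 - Y) ≥ 0`) weighted by `μ ≥ 0` and `Σ μ = 1`.
-/

namespace Summit.MatrixMultiplication.MatrixMultiplication.Theorems.PolynomialSlack

set_option linter.dupNamespace false

open scoped BigOperators

/-- **Hub mass forces one good common value.** For a probability vector `μ` on a finite type,
profiles `X, Y` with values in `[0,1]`, `h > 0`, `Z > 0`: if the hub mass `Σ μXY ≥ h` and the
forced hits `Σ XY ≤ Z`, then some `v` has `μ(v) X(v) Y(v) ≥ h² / (4Z)`.
Proof: with `μ₀ = h/(2Z)` and `m = max μXY`, pointwise `μXY ≤ μ₀ XY + (m/μ₀) μ`, so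
`h ≤ μ₀ Z + m/μ₀ = h/2 + m/μ₀`, whence `m ≥ (h/2) μ₀ = h²/(4Z)`. [folklore] -/
theorem exists_good_value_of_hubMass {ι : Type*} [Fintype ι] (μ X Y : ι → ℝ) (h Z : ℝ)
    (hμ0 : ∀ v, 0 ≤ μ v) (hμ1 : ∑ v, μ v = 1) (hX0 : ∀ v, 0 ≤ X v) (hX1 : ∀ v, X v ≤ 1)
    (hY0 : ∀ v, 0 ≤ Y v) (hY1 : ∀ v, Y v ≤ 1) (hh : 0 < h) (hZ : 0 < Z)
    (hhub : h ≤ ∑ v, μ v * (X v * Y v)) (hforced : ∑ v, X v * Y v ≤ Z) :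
    ∃ v, h ^ 2 / (4 * Z) ≤ μ v * X v * Y v := by
  classical
  -- the index type is nonempty, as `μ` has total mass one
  have hne : (Finset.univ : Finset ι).Nonempty := by
    by_contra hc
    rw [Finset.not_nonempty_iff_eq_empty] at hc
    rw [hc, Finset.sum_empty] at hμ1
    exact zero_ne_one hμ1
  -- a maximiser `v₀` of `μ X Y`, with maximum `m`
  obtain ⟨v₀, -, hv₀⟩ := Finset.exists_max_image Finset.univ (fun v => μ v * X v * Y v) hne
  refine ⟨v₀, ?_⟩
  set m : ℝ := μ v₀ * X v₀ * Y v₀ with hm_def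
  have hm : ∀ v, μ v * X v * Y v ≤ m := fun v => hv₀ v (Finset.mem_univ v)
  have hm0 : 0 ≤ m := mul_nonneg (mul_nonneg (hμ0 v₀) (hX0 v₀)) (hY0 v₀)
  -- the threshold `μ₀ = h/(2Z)`
  set μ₀ : ℝ := h / (2 * Z) with hμ₀_def
  have hμ₀0 : 0 < μ₀ := by rw [hμ₀_def]; positivity
  -- pointwise: `μXY ≤ μ₀·XY + (m/μ₀)·μ`
  have hpt : ∀ v, μ v * (X v * Y v) ≤ μ₀ * (X v * Y v) + m / μ₀ * μ v := by
    intro v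
    have hXY0 : 0 ≤ X v * Y v := mul_nonneg (hX0 v) (hY0 v)
    have hXY1 : X v * Y v ≤ 1 := by nlinarith [hX0 v, hX1 v, hY0 v, hY1 v]
    have hc0 : 0 ≤ m / μ₀ := div_nonneg hm0 hμ₀0.le
    rcases le_or_gt (μ v) μ₀ with hle | hlt
    · -- light value: `μ XY ≤ μ₀ XY`
      have h1 : μ v * (X v * Y v) ≤ μ₀ * (X v * Y v) := mul_le_mul_of_nonneg_right hle hXY0
      have h2 : 0 ≤ m / μ₀ * μ v := mul_nonneg hc0 (hμ0 v)
      linarith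
    · -- heavy value: `μ XY ≤ m ≤ (m/μ₀) μ`
      have h1 : μ v * (X v * Y v) ≤ m := by rw [← mul_assoc]; exact hm v
      have h2 : m ≤ m / μ₀ * μ v := by
        rw [div_mul_eq_mul_div, le_div_iff₀ hμ₀0]
        exact mul_le_mul_of_nonneg_left hlt.le hm0
      have h3 : 0 ≤ μ₀ * (X v * Y v) := mul_nonneg hμ₀0.le hXY0
      linarith [mul_le_mul_of_nonneg_left hXY1 (hμ0 v)]
  -- summing: `h ≤ Σ μXY ≤ μ₀ Z + m/μ₀`
  have hup : ∑ v, μ v * (X v * Y v) ≤ μ₀ * Z + m / μ₀ := by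
    calc ∑ v, μ v * (X v * Y v) ≤ ∑ v, (μ₀ * (X v * Y v) + m / μ₀ * μ v) :=
          Finset.sum_le_sum fun v _ => hpt v
      _ = μ₀ * ∑ v, X v * Y v + m / μ₀ * ∑ v, μ v := by
          rw [Finset.sum_add_distrib, Finset.mul_sum, Finset.mul_sum]
      _ ≤ μ₀ * Z + m / μ₀ := by
          rw [hμ1, mul_one]
          have : μ₀ * ∑ v, X v * Y v ≤ μ₀ * Z := mul_le_mul_of_nonneg_left hforced hμ₀0.le
          linarith
  -- `μ₀ Z = h/2`, so `h/2 ≤ m/μ₀`, i.e. `(h/2) μ₀ ≤ m`, and `(h/2) μ₀ = h²/(4Z)`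
  have hZne : Z ≠ 0 := hZ.ne'
  have hμ₀Z : μ₀ * Z = h / 2 := by rw [hμ₀_def]; field_simp
  have hkey : h / 2 ≤ m / μ₀ := by linarith
  rw [le_div_iff₀ hμ₀0] at hkey
  have hval : h / 2 * μ₀ = h ^ 2 / (4 * Z) := by rw [hμ₀_def]; field_simp; ring
  rw [← hval]
  exact hkey

/-- **The split constraint.** For a probability vector `μ` on a finite type and profiles `X, Y`
with values `≤ 1`, `Σ μX + Σ μY - 1 ≤ Σ μXY`: pointwise `X + Y - 1 ≤ XY` (as
`(1 - X)(1 - Y) ≥ 0`), weighted by `μ ≥ 0` and summed using `Σ μ = 1`. [folklore] -/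
theorem hubMass_ge_add_sub_one {ι : Type*} [Fintype ι] (μ X Y : ι → ℝ)
    (hμ0 : ∀ v, 0 ≤ μ v) (hμ1 : ∑ v, μ v = 1) (hX1 : ∀ v, X v ≤ 1) (hY1 : ∀ v, Y v ≤ 1) :
    ∑ v, μ v * X v + ∑ v, μ v * Y v - 1 ≤ ∑ v, μ v * (X v * Y v) := by
  -- pointwise `μ (X + Y - 1) ≤ μ XY`
  have h1 : ∀ v, μ v * (X v + Y v - 1) ≤ μ v * (X v * Y v) := by
    intro v
    have h0 : 0 ≤ (1 - X v) * (1 - Y v) :=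
      mul_nonneg (sub_nonneg.2 (hX1 v)) (sub_nonneg.2 (hY1 v))
    have : X v + Y v - 1 ≤ X v * Y v := by nlinarith [h0]
    exact mul_le_mul_of_nonneg_left this (hμ0 v)
  have h2 : ∑ v, μ v * (X v + Y v - 1) ≤ ∑ v, μ v * (X v * Y v) :=
    Finset.sum_le_sum fun v _ => h1 v
  have h3 : ∑ v, μ v * (X v + Y v - 1) = ∑ v, μ v * X v + ∑ v, μ v * Y v - ∑ v, μ v := by
    rw [← Finset.sum_add_distrib, ← Finset.sum_sub_distrib]
    exact Finset.sum_congr rfl fun v _ => by ring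
  rw [h3, hμ1] at h2
  exact h2

end Summit.MatrixMultiplication.MatrixMultiplication.Theorems.PolynomialSlack
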